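import Summits.CriticalPhenomena.CardyFormulaZ2.Theses.CardyBoundaryCoulombGas
import Summits.CriticalPhenomena.CardyFormulaZ2.Theorems.CardyBoundaryCoulombGasStripClusterRatesBetheKernelToolkit
import Summits.CriticalPhenomena.CardyFormulaZ2.Theorems.CardyBoundaryCoulombGasStripClusterRatesBetheRootWindow

/-!
# Escaping-index bound for the Bethe roots
# (line `two-cluster-rate-is-stationary-gap`, crux `StripClusterRates`, stmt-CriticalPhenomena-13878)

Condensation building block (counting of the roots escaping a momentum cutoff) for the Bethe-asymptotics
pillar: along every ordered positive solution `w : Fin M → ℝ` of the ground-state Bethe equations of the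
open staggered Temperley–Lieb(1) chain,
`N·F(w_j) - ∑_{l ≠ j} [G(w_j - w_l) + G(w_j + w_l)] = π (j+1)`,
`F(w) = arctan((2+√3) tanh w) + arctan(tanh w)`, `G(x) = arctan(tanh x/√3)`,
every root beyond a cutoff `Λ ≥ 0` has a LARGE index: `Λ < w_j` forces
`N·F(Λ)/π - (M-1)/3 < j+1`. Equivalently, the number of roots `w_j > Λ` is at most
`M - ⌈N·F(Λ)/π - (M-1)/3⌉`, the analogue for this chain of the escaping-root count of the condensation
method.

Proof. The landed a-priori window (`bk_betheRootWindow`) gives `N·F(w_j) ≤ π(j+1) + (π/3)(M-1)`, and `F`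
is strictly increasing (`bk_F_strictMono`), so `F(Λ) < F(w_j)`. For `N ≥ 1` this gives the strict
inequality `N·F(Λ) < π(j+1) + (π/3)(M-1)`; for `N = 0` the claim reads `-(M-1)/3 < j+1`, true since
`M ≥ 1` (the index `j` exists). Divide by `π > 0`.
-/

noncomputable section

namespace Summit.CriticalPhenomena.CardyFormulaZ2.Cruxes.StripClusterRates.TwoClusterRateIsStationaryGap

open scoped BigOperators

/-- **Escaping-index bound** (registered helper of `stmt-CriticalPhenomena-13878`): along every ordered
positive solution of the ground-state Bethe equations with `M` roots and system size `N`, a root `w_j`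
lying strictly above a cutoff `Λ ≥ 0` has index `j + 1 > N·F(Λ)/π - (M-1)/3`. [folklore] -/
theorem bu_escaping_index : ∀ (N M : ℕ) (w : Fin M → ℝ), (StrictMono w ∧ (∀ j, 0 < w j) ∧ ∀ j : Fin M, (N : ℝ) * (Real.arctan ((2 + Real.sqrt 3) * Real.tanh (w j)) + Real.arctan (Real.tanh (w j))) - ∑ l ∈ Finset.univ.erase j, (Real.arctan (Real.tanh (w j - w l) / Real.sqrt 3) + Real.arctan (Real.tanh (w j + w l) / Real.sqrt 3)) = Real.pi * ((j : ℕ) + 1)) → ∀ Λ : ℝ, 0 ≤ Λ → ∀ j : Fin M, Λ < w j → (N : ℝ) * (Real.arctan ((2 + Real.sqrt 3) * Real.tanh Λ) + Real.arctan (Real.tanh Λ)) / Real.pi - ((M : ℝ) - 1) / 3 < (j : ℕ) + 1 := by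
  intro N M w hw Λ _hΛ j hΛj
  -- upper a-priori window at the root `w_j`
  have hup := (bk_betheRootWindow N M w hw j).2
  -- strict monotonicity of the momentum phase `F`
  have hF : Real.arctan ((2 + Real.sqrt 3) * Real.tanh Λ) + Real.arctan (Real.tanh Λ) <
      Real.arctan ((2 + Real.sqrt 3) * Real.tanh (w j)) + Real.arctan (Real.tanh (w j)) :=
    bk_F_strictMono hΛj
  have hM : (1 : ℝ) ≤ (M : ℝ) := by exact_mod_cast Nat.succ_le_of_lt (Fin.pos j)
  have hj0 : (0 : ℝ) ≤ ((j : ℕ) : ℝ) := Nat.cast_nonneg _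
  have hπ := Real.pi_pos
  -- the strict bound `N·F(Λ) < π(j+1) + (π/3)(M-1)`, by cases on `N = 0`
  have key : (N : ℝ) * (Real.arctan ((2 + Real.sqrt 3) * Real.tanh Λ) + Real.arctan (Real.tanh Λ)) <
      Real.pi * (((j : ℕ) : ℝ) + 1) + Real.pi / 3 * ((M : ℝ) - 1) := by
    rcases Nat.eq_zero_or_pos N with hN | hN
    · subst hN
      rw [Nat.cast_zero, zero_mul]
      nlinarith
    · have hN' : (0 : ℝ) < (N : ℝ) := by exact_mod_cast hN
      have hlt := mul_lt_mul_of_pos_left hF hN'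
      linarith
  have hdiv : (N : ℝ) * (Real.arctan ((2 + Real.sqrt 3) * Real.tanh Λ) + Real.arctan (Real.tanh Λ)) / Real.pi <
      ((j : ℕ) : ℝ) + 1 + ((M : ℝ) - 1) / 3 := by
    rw [div_lt_iff₀ hπ]
    linarith
  linarith

end Summit.CriticalPhenomena.CardyFormulaZ2.Cruxes.StripClusterRates.TwoClusterRateIsStationaryGap
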